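import Mathlib
import Summits.MatrixMultiplication.MatrixMultiplication.Theorems.FidelityWitnessesRankTwoAdditivityTwoByTwo

/-!
# `FidelityWitnesses.RankTwoAdditivity` (stmt-MatrixMultiplication-4964) — balanced-block chain

Cayley–Hamilton and adjugate identities for 2×2 matrices, the block identities of a balanced rank-two projector
(`balanced_blocks`: `KKᴴ = KᴴK = κ²·1`, `Kᴴ(1−P)K = κ²·Q`, `|det K| = det P = κ²`), and the chain
`bal_chain`: `|c|² ≤ tr(P(1−D)) tr(Q(1−D₁))` from the rank-two von Neumann bound — the matrix-level content of
the balanced case of the key lemma for the core inequality.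
Supports item `stmt-MatrixMultiplication-4964`; no definitions are introduced.
-/

namespace Summit.MatrixMultiplication.MatrixMultiplication.Theorems.RankTwoAdditivity

open scoped BigOperators ComplexConjugate ComplexOrder Matrix

/-- Cayley–Hamilton for 2×2 matrices. -/
theorem cayley_hamilton_fin_two (C : Matrix (Fin 2) (Fin 2) ℂ) : C * C = C.trace • C - C.det • (1 : Matrix _ _ ℂ) := by
  ext i j
  rw [Matrix.trace_fin_two, Matrix.det_fin_two]
  fin_cases i <;> fin_cases j <;>
    simp [Matrix.mul_apply, Fin.sum_univ_two] <;> ring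

/-- `det (1 − C) = 1 − tr C + det C` for 2×2 matrices. -/
theorem det_one_sub_fin_two (C : Matrix (Fin 2) (Fin 2) ℂ) : (1 - C).det = 1 - C.trace + C.det := by
  rw [Matrix.det_fin_two, Matrix.det_fin_two, Matrix.trace_fin_two]
  simp
  ring

/-- `adj P = tr P • 1 − P` for 2×2 matrices. -/
theorem adjugate_fin_two_eq (P : Matrix (Fin 2) (Fin 2) ℂ) : P.adjugate = P.trace • (1 : Matrix _ _ ℂ) - P := by
  rw [Matrix.adjugate_fin_two, Matrix.trace_fin_two]
  ext i j
  fin_cases i <;> fin_cases j <;> simp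

/-- Real part of the trace is monotone against a positive semidefinite weight:
`X, Y ⪰ 0 ⟹ 0 ≤ Re tr(XY)` restated for differences. -/
theorem trace_re_mono_fin_two (X Y Z : Matrix (Fin 2) (Fin 2) ℂ) (hX : X.PosSemidef) (hYZ : (Z - Y).PosSemidef) :
    ((X * Y).trace).re ≤ ((X * Z).trace).re := by
  have h := trace_mul_re_nonneg_fin_two X (Z - Y) hX hYZ
  rw [Matrix.mul_sub, Matrix.trace_sub, Complex.sub_re] at h
  linarith

/-- Block identities for a balanced rank-two projector `Π = VVᴴ`, `V = [E₀; E₁]` (2×2 blocks):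
with `C = E₀ᴴE₀`, `κ² = |det E₀|²`, `P = E₀E₀ᴴ`, `K = E₀E₁ᴴ`, `Q = E₁E₁ᴴ` one has
`KKᴴ = KᴴK = κ²·1`, `Kᴴ(1−P)K = κ²·Q`, `|det K| = κ²`, `det P = κ²`, `tr P = tr Q = 1`. -/
theorem balanced_blocks (E₀ E₁ : Matrix (Fin 2) (Fin 2) ℂ)
    (hiso : E₀ᴴ * E₀ + E₁ᴴ * E₁ = 1) (hbal : (E₀ᴴ * E₀).trace = 1) :
    (E₀ * E₁ᴴ) * (E₀ * E₁ᴴ)ᴴ = ((‖E₀.det‖ ^ 2 : ℝ) : ℂ) • (1 : Matrix (Fin 2) (Fin 2) ℂ)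
    ∧ (E₀ * E₁ᴴ)ᴴ * (E₀ * E₁ᴴ) = ((‖E₀.det‖ ^ 2 : ℝ) : ℂ) • (1 : Matrix (Fin 2) (Fin 2) ℂ)
    ∧ (E₀ * E₁ᴴ)ᴴ * (1 - E₀ * E₀ᴴ) * (E₀ * E₁ᴴ) = ((‖E₀.det‖ ^ 2 : ℝ) : ℂ) • (E₁ * E₁ᴴ)
    ∧ ‖(E₀ * E₁ᴴ).det‖ = ‖E₀.det‖ ^ 2
    ∧ (E₀ * E₀ᴴ).det = ((‖E₀.det‖ ^ 2 : ℝ) : ℂ)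
    ∧ (E₀ * E₀ᴴ).trace = 1 ∧ (E₁ * E₁ᴴ).trace = 1 := by
  set C := E₀ᴴ * E₀ with hC
  set κ2 : ℝ := ‖E₀.det‖ ^ 2 with hκ2
  have hC1 : E₁ᴴ * E₁ = 1 - C := by rw [← hiso]; abel
  have hdetC : C.det = (κ2 : ℂ) := by
    rw [hC, Matrix.det_mul, Matrix.det_conjTranspose, Complex.star_def, hκ2, Complex.ofReal_pow,
      ← Complex.mul_conj', mul_comm]
  have hdetP : (E₀ * E₀ᴴ).det = (κ2 : ℂ) := by
    rw [Matrix.det_mul, Matrix.det_conjTranspose, Complex.star_def, hκ2, Complex.ofReal_pow, ← Complex.mul_conj']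
  have htrP : (E₀ * E₀ᴴ).trace = 1 := by rw [Matrix.trace_mul_comm]; exact hbal
  have htrQ : (E₁ * E₁ᴴ).trace = 1 := by
    rw [Matrix.trace_mul_comm, hC1, Matrix.trace_sub, Matrix.trace_one, hbal]
    simp only [Fintype.card_fin]; norm_num
  -- |det E₁|² = κ²
  have hdetE₁ : star E₁.det * E₁.det = (κ2 : ℂ) := by
    have : (E₁ᴴ * E₁).det = (1 - C).det := by rw [hC1]
    rw [Matrix.det_mul, Matrix.det_conjTranspose, det_one_sub_fin_two, hbal, hdetC] at this
    rw [this]; ring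
  have hnormE₁ : ‖E₁.det‖ = ‖E₀.det‖ := by
    have h1 : ‖E₁.det‖ ^ 2 = κ2 := by
      have := congrArg Complex.re hdetE₁
      rw [Complex.star_def, Complex.conj_mul', ← Complex.ofReal_pow, Complex.ofReal_re, Complex.ofReal_re] at this
      exact this
    rw [hκ2] at h1
    nlinarith [norm_nonneg E₁.det, norm_nonneg E₀.det, sq_nonneg (‖E₁.det‖ - ‖E₀.det‖),
      sq_nonneg (‖E₁.det‖ + ‖E₀.det‖)]
  have hdetK : ‖(E₀ * E₁ᴴ).det‖ = κ2 := by
    rw [Matrix.det_mul, Matrix.det_conjTranspose, norm_mul, Complex.star_def, Complex.norm_conj, hnormE₁, hκ2]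
    ring
  -- Cayley–Hamilton consequences
  have hPP : (E₀ * E₀ᴴ) * (E₀ * E₀ᴴ) = E₀ * E₀ᴴ - (κ2 : ℂ) • (1 : Matrix (Fin 2) (Fin 2) ℂ) := by
    rw [cayley_hamilton_fin_two, htrP, hdetP, one_smul]
  have hKKh : (E₀ * E₁ᴴ) * (E₀ * E₁ᴴ)ᴴ = (κ2 : ℂ) • (1 : Matrix (Fin 2) (Fin 2) ℂ) := by
    rw [Matrix.conjTranspose_mul, Matrix.conjTranspose_conjTranspose]
    have : E₀ * E₁ᴴ * (E₁ * E₀ᴴ) = E₀ * (E₁ᴴ * E₁) * E₀ᴴ := by simp only [Matrix.mul_assoc]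
    rw [this, hC1, Matrix.mul_sub, Matrix.mul_one, Matrix.sub_mul, hC]
    have : E₀ * (E₀ᴴ * E₀) * E₀ᴴ = (E₀ * E₀ᴴ) * (E₀ * E₀ᴴ) := by simp only [Matrix.mul_assoc]
    rw [this, hPP]; abel
  have hCC : C * C = C - (κ2 : ℂ) • (1 : Matrix (Fin 2) (Fin 2) ℂ) := by
    rw [cayley_hamilton_fin_two, hbal, hdetC, one_smul]
  have hQ : E₁ * C * E₁ᴴ = (κ2 : ℂ) • (1 : Matrix (Fin 2) (Fin 2) ℂ) := by
    -- E₁ C E₁ᴴ = E₁ (1 − E₁ᴴE₁) E₁ᴴ = Q − Q², and Q² = Q − det Q • 1 with det Q = κ²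
    have hC' : C = 1 - E₁ᴴ * E₁ := by rw [hC1]; abel
    have hdetQ : (E₁ * E₁ᴴ).det = (κ2 : ℂ) := by
      rw [Matrix.det_mul, Matrix.det_conjTranspose, mul_comm]; exact hdetE₁
    have hQQ : (E₁ * E₁ᴴ) * (E₁ * E₁ᴴ) = E₁ * E₁ᴴ - (κ2 : ℂ) • (1 : Matrix (Fin 2) (Fin 2) ℂ) := by
      rw [cayley_hamilton_fin_two, htrQ, hdetQ, one_smul]
    rw [hC', Matrix.mul_sub, Matrix.mul_one, Matrix.sub_mul]
    have : E₁ * (E₁ᴴ * E₁) * E₁ᴴ = (E₁ * E₁ᴴ) * (E₁ * E₁ᴴ) := by simp only [Matrix.mul_assoc]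
    rw [this, hQQ]; abel
  have hKhK : (E₀ * E₁ᴴ)ᴴ * (E₀ * E₁ᴴ) = (κ2 : ℂ) • (1 : Matrix (Fin 2) (Fin 2) ℂ) := by
    rw [Matrix.conjTranspose_mul, Matrix.conjTranspose_conjTranspose]
    have : E₁ * E₀ᴴ * (E₀ * E₁ᴴ) = E₁ * (E₀ᴴ * E₀) * E₁ᴴ := by simp only [Matrix.mul_assoc]
    rw [this, ← hC, hQ]
  have hKPK : (E₀ * E₁ᴴ)ᴴ * (1 - E₀ * E₀ᴴ) * (E₀ * E₁ᴴ) = (κ2 : ℂ) • (E₁ * E₁ᴴ) := by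
    rw [Matrix.mul_sub, Matrix.mul_one, Matrix.sub_mul, hKhK, Matrix.conjTranspose_mul,
      Matrix.conjTranspose_conjTranspose]
    have : E₁ * E₀ᴴ * (E₀ * E₀ᴴ) * (E₀ * E₁ᴴ) = E₁ * ((E₀ᴴ * E₀) * (E₀ᴴ * E₀)) * E₁ᴴ := by
      simp only [Matrix.mul_assoc]
    rw [this, ← hC, hCC, Matrix.mul_sub, Matrix.sub_mul, hQ, Matrix.mul_smul, Matrix.mul_one, Matrix.smul_mul]
    abel
  exact ⟨hKKh, hKhK, hKPK, hdetK, hdetP, htrP, htrQ⟩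

/-- **The balanced-block chain.** For a balanced rank-two projector with blocks `P = E₀E₀ᴴ, K = E₀E₁ᴴ,
Q = E₁E₁ᴴ`, positive semidefinite `D, D₁` with `D + D₁ ⪯ 1`, and a number `c` obeying the rank-two von Neumann
bound `|c|² ≤ tr(D K D₁ Kᴴ) + 2|det K| √(det D det D₁)`, one has `|c|² ≤ tr(P(1−D)) · tr(Q(1−D₁))`.
(Chain: monotonicity, the 2×2 swap identity `F(D, 1−D_Y) = F(1−D, D_Y)`, Hölder with weight `P`,
`κ² P⁻¹ = adj P = 1 − P`.) -/
theorem bal_chain (E₀ E₁ D D₁ : Matrix (Fin 2) (Fin 2) ℂ) (c : ℂ)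
    (hiso : E₀ᴴ * E₀ + E₁ᴴ * E₁ = 1) (hbal : (E₀ᴴ * E₀).trace = 1)
    (hD : D.PosSemidef) (hD₁ : D₁.PosSemidef) (hsum : (1 - D - D₁).PosSemidef)
    (hV : ‖c‖ ^ 2 ≤ ((D * (E₀ * E₁ᴴ) * D₁ * (E₀ * E₁ᴴ)ᴴ).trace).re
        + 2 * ‖(E₀ * E₁ᴴ).det‖ * Real.sqrt ((D.det).re * (D₁.det).re)) :
    ‖c‖ ^ 2 ≤ (((E₀ * E₀ᴴ) * (1 - D)).trace).re * (((E₁ * E₁ᴴ) * (1 - D₁)).trace).re := by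
  obtain ⟨hKKh, hKhK, hKPK, hdetK, hdetP, htrP, htrQ⟩ := balanced_blocks E₀ E₁ hiso hbal
  set P := E₀ * E₀ᴴ with hPdef
  set K := E₀ * E₁ᴴ with hKdef
  set Q := E₁ * E₁ᴴ with hQdef
  set κ2 : ℝ := ‖E₀.det‖ ^ 2 with hκ2
  have hκ2nn : 0 ≤ κ2 := by positivity
  have hPpsd : P.PosSemidef := Matrix.posSemidef_self_mul_conjTranspose E₀
  have hQpsd : Q.PosSemidef := Matrix.posSemidef_self_mul_conjTranspose E₁
  have h1D : (1 - D).PosSemidef := by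
    have := hsum.add hD₁; simpa only [sub_add_cancel] using this
  have h1D₁ : (1 - D₁).PosSemidef := by
    have := hsum.add hD
    have e : 1 - D - D₁ + D = 1 - D₁ := by abel
    simpa only [e] using this
  -- the target is nonnegative
  have hT₁ : 0 ≤ ((P * (1 - D)).trace).re := trace_mul_re_nonneg_fin_two P (1 - D) hPpsd h1D
  have hT₂ : 0 ≤ ((Q * (1 - D₁)).trace).re := trace_mul_re_nonneg_fin_two Q (1 - D₁) hQpsd h1D₁
  -- step A: tr(D K D₁ Kᴴ) = tr(X D₁) ≤ tr(X (1−D)) = κ² tr D − tr(X D),  X = Kᴴ D K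
  set X := Kᴴ * D * K with hX
  have hXpsd : X.PosSemidef := hD.conjTranspose_mul_mul_same K
  have eA : (D * K * D₁ * Kᴴ).trace = (X * D₁).trace := by
    rw [hX, Matrix.trace_mul_cycle, ← Matrix.mul_assoc]
  have hA : ((X * D₁).trace).re ≤ ((X * (1 - D)).trace).re := by
    apply trace_re_mono_fin_two X D₁ (1 - D) hXpsd
    have e : 1 - D - D₁ = (1 - D) - D₁ := by abel
    rw [← e]; exact hsum
  have eX1 : (X * (1 - D)).trace = (κ2 : ℂ) * D.trace - (X * D).trace := by
    rw [Matrix.mul_sub, Matrix.mul_one, Matrix.trace_sub, hX, Matrix.trace_mul_cycle, hKKh, Matrix.smul_mul,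
      Matrix.one_mul, Matrix.trace_smul, smul_eq_mul]
  -- step B: det D₁ ≤ det (1 − D)
  have hB : (D₁.det).re ≤ ((1 - D).det).re := by
    have := det_mono_fin_two D₁ (1 - D - D₁) hD₁ hsum
    have e : D₁ + (1 - D - D₁) = 1 - D := by abel
    rwa [e] at this
  have hdetD : 0 ≤ (D.det).re := (Complex.nonneg_iff.1 hD.det_nonneg).1
  have hdetD₁ : 0 ≤ (D₁.det).re := (Complex.nonneg_iff.1 hD₁.det_nonneg).1
  have hsqrt : Real.sqrt ((D.det).re * (D₁.det).re) ≤ Real.sqrt ((D.det).re * ((1 - D).det).re) :=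
    Real.sqrt_le_sqrt (mul_le_mul_of_nonneg_left hB hdetD)
  -- combine A and B:  |c|² ≤ RHS₂ := κ² tr D − tr(XD) + 2 κ² √(det D det(1−D))
  have hRHS₂ : ‖c‖ ^ 2 ≤ κ2 * (D.trace).re - ((X * D).trace).re
      + 2 * κ2 * Real.sqrt ((D.det).re * ((1 - D).det).re) := by
    rw [eA, hdetK] at hV
    have hA' : ((X * D₁).trace).re ≤ κ2 * (D.trace).re - ((X * D).trace).re := by
      rw [eX1, Complex.sub_re, Complex.re_ofReal_mul] at hA; exact hA
    have := mul_le_mul_of_nonneg_left hsqrt (by positivity : 0 ≤ 2 * κ2)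
    nlinarith [hA', this, hV]
  -- step C: Hölder with A = 1 − D, B = K D Kᴴ, weight P = E₀E₀ᴴ
  have hKDK : (K * D * Kᴴ).PosSemidef := hD.mul_mul_conjTranspose_same K
  have hH := holder_fin_two (1 - D) (K * D * Kᴴ) E₀ h1D hKDK
  -- identify the pieces of Hölder
  have eP : ((E₀ * E₀ᴴ).det).re = κ2 := by rw [hdetP, Complex.ofReal_re]
  have e1 : (K * D * Kᴴ).trace = (κ2 : ℂ) * D.trace := by
    rw [Matrix.trace_mul_cycle, hKhK, Matrix.smul_mul, Matrix.one_mul, Matrix.trace_smul, smul_eq_mul]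
  have e2 : (D * (K * D * Kᴴ)).trace = (X * D).trace := by
    rw [show D * (K * D * Kᴴ) = (D * K * D) * Kᴴ by simp only [Matrix.mul_assoc], Matrix.trace_mul_comm, hX]
    simp only [Matrix.mul_assoc]
  have eAB : ((1 - D) * (K * D * Kᴴ)).trace = (κ2 : ℂ) * D.trace - (X * D).trace := by
    rw [Matrix.sub_mul, Matrix.one_mul, Matrix.trace_sub, e1, e2]
  have edetA : ((K * D * Kᴴ).det).re = κ2 ^ 2 * (D.det).re := by
    rw [Matrix.det_mul, Matrix.det_mul, Matrix.det_conjTranspose, Complex.star_def]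
    have : K.det * D.det * conj K.det = ((‖K.det‖ ^ 2 : ℝ) : ℂ) * D.det := by
      rw [Complex.ofReal_pow, ← Complex.mul_conj']
      ring
    rw [this, Complex.re_ofReal_mul, hdetK]
  have eadj : (E₀ * E₀ᴴ).adjugate = 1 - P := by rw [adjugate_fin_two_eq, htrP, one_smul]
  have eBadj : ((K * D * Kᴴ) * (E₀ * E₀ᴴ).adjugate).trace = (κ2 : ℂ) * (D * Q).trace := by
    rw [eadj]
    have e3 : (K * D * Kᴴ) * (1 - P) = K * (D * (Kᴴ * (1 - P))) := by simp only [Matrix.mul_assoc]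
    rw [e3, Matrix.trace_mul_comm]
    have e4 : D * (Kᴴ * (1 - P)) * K = D * (Kᴴ * (1 - P) * K) := by simp only [Matrix.mul_assoc]
    rw [e4, hKPK, Matrix.mul_smul, Matrix.trace_smul, smul_eq_mul]
  rw [eP, eAB, edetA, eBadj, Complex.sub_re, Complex.re_ofReal_mul, Complex.re_ofReal_mul] at hH
  have hsq2 : Real.sqrt (((1 - D).det).re * (κ2 ^ 2 * (D.det).re))
      = κ2 * Real.sqrt ((D.det).re * ((1 - D).det).re) := by
    have : ((1 - D).det).re * (κ2 ^ 2 * (D.det).re) = κ2 ^ 2 * ((D.det).re * ((1 - D).det).re) := by ring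
    rw [this, Real.sqrt_mul (by positivity), Real.sqrt_sq hκ2nn]
  rw [hsq2] at hH
  -- hH : κ2 * (κ2 trD − tr(XD)) + 2 κ2 (κ2 √…) ≤ tr((1−D)P) · (κ2 · tr(DQ))
  have ePcomm : (((1 - D) * (E₀ * E₀ᴴ)).trace).re = ((P * (1 - D)).trace).re := by
    rw [Matrix.trace_mul_comm]
  rw [ePcomm] at hH
  -- tr(DQ) ≤ tr((1 − D₁) Q) = tr(Q (1 − D₁))
  have hDQ : ((D * Q).trace).re ≤ ((Q * (1 - D₁)).trace).re := by
    rw [Matrix.trace_mul_comm]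
    apply trace_re_mono_fin_two Q D (1 - D₁) hQpsd
    have e : (1 - D₁) - D = 1 - D - D₁ := by abel
    rw [e]; exact hsum
  -- case split on κ²
  rcases hκ2nn.lt_or_eq with hpos | hzero
  · -- κ² > 0: divide the Hölder inequality by κ²
    have hmain : κ2 * (D.trace).re - ((X * D).trace).re + 2 * κ2 * Real.sqrt ((D.det).re * ((1 - D).det).re)
        ≤ ((P * (1 - D)).trace).re * ((D * Q).trace).re := by
      have h' : κ2 * (κ2 * (D.trace).re - ((X * D).trace).re
          + 2 * κ2 * Real.sqrt ((D.det).re * ((1 - D).det).re))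
          ≤ κ2 * (((P * (1 - D)).trace).re * ((D * Q).trace).re) := by nlinarith [hH]
      exact le_of_mul_le_mul_left h' hpos
    calc ‖c‖ ^ 2 ≤ _ := hRHS₂
      _ ≤ ((P * (1 - D)).trace).re * ((D * Q).trace).re := hmain
      _ ≤ ((P * (1 - D)).trace).re * ((Q * (1 - D₁)).trace).re := mul_le_mul_of_nonneg_left hDQ hT₁
  · -- κ² = 0: then K = 0 and the von Neumann bound forces c = 0
    have hK0 : K = 0 := by
      have h0 : Kᴴᴴ * Kᴴ = 0 := by rw [Matrix.conjTranspose_conjTranspose, hKKh, ← hzero]; simp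
      have := Matrix.conjTranspose_mul_self_eq_zero.1 h0
      simpa using congrArg Matrix.conjTranspose this
    have : ‖c‖ ^ 2 ≤ 0 := by
      have h := hV
      rw [hK0] at h
      simpa using h
    nlinarith [mul_nonneg hT₁ hT₂]

end Summit.MatrixMultiplication.MatrixMultiplication.Theorems.RankTwoAdditivity
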